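import Summits.ResolutionOfSingularities.ResolutionOfSingularities.Theorems.FrobeniusLadderFRationalResolutionDiagQuotientSurfaceAllFields
import Literature.AlgebraicGeometry.Resolution.AlterationsDimension
import Literature.AlgebraicGeometry.Resolution.QuasiProjectiveResolution
import Mathlib.AlgebraicGeometry.Morphisms.Proper
import HarnessLib

/-!
# Crux `FrobeniusLadder.FRationalResolution` (stmt-ResolutionOfSingularities-15317), line `redirect` —
# **rung 4′ for SURFACES reduces to lrq-ification alone**: a surface with a diagonalizable-quotient model is
# resolvable over every field

The composition `integralCore` of the skeleton `Lines/redirect.lean` (X₂ = `stub_quotientModel` ∘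
`stub_diagonalizableQuotientResolution`) with the second factor now PROVED in dimension `≤ 2` over every field
(`…DiagQuotientSurfaceAllFields.hasResolution_of_quotient_surface`, leafhand-2 g9):

* **`hasResolution_surface_of_quotientModel`** — an integral separated finite-type SURFACE `X/k` (any field)
  admitting a proper birational INTEGRAL model `X' → X` every point of which lies in the image of an étale
  `k`-morphism from the degree-`0` part of a regular finite-type `k`-algebra graded by a finite abelian group
  (the conclusion of `stub_quotientModel`, verbatim) has a resolution of singularities. So in dimension 2 the piece
  X₂ (`WeaklyFRegularResolution`) is EXACTLY the lrq-ification statement `stub_quotientModel` (LMM 2021 Thm 1.6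
  territory), with no residual on the resolution side.

Honest label: assembly (no stub, crux or summit closed by name). No definitions, no named facts, no sorry.
[cite: Kollar2007, §2.2] [folklore]
-/

noncomputable section

-- single-problem summit: the doubled namespace component is forced
set_option linter.dupNamespace false

open CategoryTheory AlgebraicGeometry TopologicalSpace
open Literature.AlgebraicGeometry.Resolution
open Summit.ResolutionOfSingularities.ResolutionOfSingularities.Theorems.FRationalResolution

namespace Summit.ResolutionOfSingularities.ResolutionOfSingularities.Theorems.FRationalResolution.SurfaceOfQuotientModel

/-- **A surface with a diagonalizable-quotient model is resolvable, over every field.** See the module docstring.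
[cite: Kollar2007, §2.2] -/
theorem hasResolution_surface_of_quotientModel (k : Type) [Field k] (X : Scheme.{0})
    (f : X ⟶ Spec (.of k)) [IsSeparated f] [LocallyOfFiniteType f] [QuasiCompact f] [IsIntegral X]
    (hdim : topologicalKrullDim X ≤ 2)
    (hmodel : ∃ (X' : Scheme.{0}) (π : X' ⟶ X), IsProper π ∧ IsBirational π ∧ IsIntegral X' ∧
      ∀ x : X', ∃ (A : Type) (_ : AddCommGroup A) (_ : Finite A) (_ : DecidableEq A)
        (S : Type) (_ : CommRing S) (_ : Algebra k S) (𝒮 : A → Submodule k S)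
        (_ : GradedAlgebra 𝒮), Algebra.FiniteType k S ∧ IsRegularRing S ∧
        ∃ φ : Spec (.of (𝒮 0)) ⟶ X', Etale φ ∧ x ∈ Set.range φ ∧
          φ ≫ π ≫ f = Spec.map (CommRingCat.ofHom (algebraMap k (𝒮 0)))) :
    Scheme.HasResolution X := by
  obtain ⟨X', π, hπ, hbir, hint', hq⟩ := hmodel
  haveI := hπ
  haveI := hint'
  -- the model is again a surface
  have hdim' : topologicalKrullDim X' ≤ 2 := by
    obtain ⟨U, hUd, -, hiso⟩ := hbir
    have hUne : (U : Set X).Nonempty := hUd.nonempty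
    haveI := hiso
    -- `π⁻¹(U) ≅ U` is a non-empty open of `X'` and an open of `X` (as in `…ModelDimension`)
    have hne' : ((π ⁻¹ᵁ U : X'.Opens) : Set X').Nonempty := by
      obtain ⟨u, hu⟩ := hUne
      let y : ↥(π ⁻¹ᵁ U) := (inv (π ∣_ U)).base ⟨u, hu⟩
      exact ⟨y.1, y.2⟩
    haveI : Nonempty (↑(π ⁻¹ᵁ U) : Scheme.{0}) := hne'.to_subtype
    rw [← topologicalKrullDim_opens_eq (π ≫ f) (π ⁻¹ᵁ U) hne',
      topologicalKrullDim_eq_of_isOpenImmersion f ((π ∣_ U) ≫ U.ι)]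
    exact hdim
  refine Scheme.HasResolution.of_isBirational π hbir ?_
  exact DiagQuotientSurfaceAllFields.hasResolution_of_quotient_surface k X' (π ≫ f) (fun x => by
    obtain ⟨A, iA, fA, dA, S, iS, aS, 𝒮, gS, hft, hreg, φ, hφ, hx, hcomp⟩ := hq x
    exact ⟨A, iA, fA, dA, S, iS, aS, 𝒮, gS, hft, hreg, φ, hφ, hx, by rw [← hcomp]⟩) hdim'

end Summit.ResolutionOfSingularities.ResolutionOfSingularities.Theorems.FRationalResolution.SurfaceOfQuotientModel

end
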